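import Summits.QuantumFields.BalabanUV.T4Continuum.Spine.NE1p.DressedRoot
import Summits.QuantumFields.BalabanUV.T4Continuum.Support.T4TrajectoryDensityWitnessK2

/-!
# T⁴ programme, spine estimate NE1′ (node O3b/H2) — NON-VACUITY OF END-F AT FUNCTION LEVEL WITH THE DRESSED BUDGET GATE
# ACTIVE, and END-B's per-cutoff face behind it (formalisation crew `b2b-balaban-t4-ne1p-formalise-*`, leaf seat 03;
# own-initiative consistency item, NOT a crew row, NOT an estimate)

Cell `pub-balaban`, sub-cell `t4`, BINDER-OWNERS row NE1′ (owner lineage t4-ne1p-p1; root `Spine/NE1p/DressedRoot.lean`,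
p211416).  ADDITIVE — imports `Spine/NE1p/DressedRoot` and the lineage's K = 2 toy `Support/T4TrajectoryDensityWitnessK2`
ONLY, modifies nothing.

WHY THIS FILE.  The trigger's non-vacuity check (t5) is met at BOOKING level by `Spine/NE1p/DressedRootWitness` (a toy tower
meets the root THROUGH END-B `dressedStability_of_bookingLeaves` at every cutoff with one `UniformConstants`; there the
transport leaf `htr` is supplied directly at booking level), and at FUNCTION level by the lineage's joint witness
`T4TrajectoryDensityWitness.transportsFromVar_K2` — but that one inhabits the binders of the PRE-gate, PRE-centring,
single-index capstone `transportsFromVar_of_exponentSlicesAt_lattice` with `Gate ≡ True`.  END-F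
(`DressedRoot.transportLeaf_of_centredExponent`) has a different binder family: per-family indices `(b, k′, k)`, the SPLIT
exponent `𝒜 + 𝒬` with the CENTRED perturbation slice `hP` of size LITERALLY `m·Σ_{f ∈ S k b} envVar`, the uniform step constant
`e³` in `hdom`, and the gate `budgetGate T s m S (4c_δ/r) (ψ·α)` itself threaded through every history premise.  This file
discharges ALL 21 of END-F's hypothesis binders SIMULTANEOUSLY on ONE datum, obtains `htr` BY NAME through END-F, packages it with the
other leaf binders into a `BookingLeaves U` for ONE rational `U : UniformConstants`, and reads off END-B's per-cutoff face
`classAt_of_bookingLeaves`: the class AND every dressed budget gate along the trajectory — END-F then END-B exercised end to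
end at function level.  On the same datum the gate is a GENUINE constraint (`not_budgetGate_of_unit_source`: with source
factor `m = 1` instead of `2⁻²²` the budget fails at scale `0`), so (w6) `hsmall` is load-bearing in the composition.

THE DATUM (the lineage's toy, `T4TrajectoryDensityWitness` parts 1–2, by name): `d = 4`, `R = F = ℂ`; booking
`Bk = oneBirth 2` (one family born at scale `0`, `K = 2`), trajectory `Tr` (`lin = [k′ = 0]`, `gen = 80·[k′ = 0]`), windows
`Win k = bondBall 4 (5 − 2k)`, fluctuation measure `flTwo = δ_0 + δ_{z_H}`, carried functionals `Fn` DEFINED by the `wOp`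
recursion with weight `base₁·e^{−𝒜₁}`, `𝒜₁ U z = U₀₀ z₀₀/10`, reference `ref₁ = Re`.  NEW here (§1): the toy exponent is
SPLIT as `𝒜₁ = 𝒜w + 𝒬w` into an ACTION part `𝒜w` and an OBSERVABLE-ATTACHED part
`𝒬w U z = U₀₀/50 + 𝒜₁ U z/2000` — a fluctuation-CONSTANT piece `qw U = U₀₀/50` (centred away for free: END-F recentres by
`wOp_expWeight_add_zconst`) plus a fluctuation-DEPENDENT piece whose centred slice is PAID FROM THE DRESSED BUDGET
`m·Σ_{f ∈ S k b} envVar (4c_δ/r) (ψ·α) f k` with live families `S k b = {b}` (`k ≤ 2`) and source factor `m = 2⁻²²`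
(§2 `pertSlice_w`, §3 `budget_ge`).  Constants: `c_δ = defect = 1/5`, `r = w = θ = ψ = 1`, `ϱ = 4`, `s = 1/2`, `α ≡ 64`
(`hdom`: `e³·(1 + 4θ/ϱ) = 2e³ ≤ 64`, §3 `exp_three_le`), `rel = Eq`, `z₀ = 0`, `D = bondBall 4 ½`;
`U = (C, A₀, ρ₁, τ, Λ, N₀, ρ′, s̄⁰, m) = (4/5, 64, 64, 1, 1/128, 16384, 1/2, 1/2, 2⁻²²)` with (w7) `Λρ₁τ = ρ′` and (w6)
`m·N₀A₀(1−ρ′)⁻¹ = 1 − s̄⁰` EQUALITIES (§4).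

WHAT IT IS NOT.  Not the tower-level witness (every cutoff with one `U`: that is `DressedRootWitness`, booking level); not an
estimate; nothing of Bałaban's densities or of [Balaban1989LargeFieldII] (1.71)–(1.75) pp. 379–380 is encoded (CONTEXT only,
carried by the imported headers); no `def … : Prop`; every declaration is [folklore] toy kernel mathematics, 0 sorry,
0 citations.  It says NOTHING about whether the cell's D-terms meet END-F's shapes (the wall (w1)–(w7) of the record
`t4/T4-EST-NE1p-P1.md` §4 is unchanged): VALUE = a joint-satisfiability certificate for END-F's 21 binders together with
END-B's per-cutoff leaf binders and a non-trivial dressed budget.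

HONEST FRAMING.  Rung (B)+1 bookkeeping on ONE finite four-torus of fixed physical size — NOT infinite volume, NOT a mass
gap, NOT OS on ℝ⁴, NOT the Clay problem, NOT summit progress.  NE1′ is NOT PRINTED and NOT PROVED; every headline reads
«NE1′ ⇐ the named binders» / «L-T ⇐ F-1…F-9»; spine PROVED 0∕9 unchanged.  HONEST DEPENDENCY: continuum YM on T⁴ ⇐
BetaPertH ∧ nine spine estimates (0/9 proved); BetaPertH ⇐ (D1) ∧ (D4) ∧ CAP+tail; G-an2-4 gates asym, D1 and NE2/3/4.
-/

noncomputable section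

namespace Summit.QuantumFields.BalabanUV.T4Continuum.NE1p.DressedTransportWitness

open MeasureTheory Set Metric Filter Finset
open scoped BigOperators
open Literature.MathematicalPhysics.QuantumFieldTheory.Balaban1983to89
open Literature.MathematicalPhysics.QuantumFieldTheory.Balaban1983to89.T4TermFormat
open Literature.MathematicalPhysics.QuantumFieldTheory.Balaban1983to89.T4TermFormat.Booking
open Literature.MathematicalPhysics.QuantumFieldTheory.Balaban1983to89.T4GatedBooking
open Literature.MathematicalPhysics.QuantumFieldTheory.Balaban1983to89.T4TrajectoryComparison
open T4TrajectoryModulus (bondBall bondBall_add_mem bondBall_latMove_add_mem bondBall_diam)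
open T4BlockTransport (Fld NDir latMove latN Site norm_dir_le)
open T4BirthChartTransport (GaugeInvariant BirthSlice RelGauge)
open T4TrajectoryDensity
open Summit.QuantumFields.BalabanUV.T4Continuum.T4TrajectoryDensityDressed
open Summit.QuantumFields.BalabanUV.T4Continuum.T4TrajectoryDensityWitness
open Summit.QuantumFields.BalabanUV.T4Continuum.NE1p.DressedRoot

/-! ## §1 The split of the toy exponent into an action part and an observable-attached part [folklore] -/

/-- The OBSERVABLE-ATTACHED part of the toy exponent: a fluctuation-constant piece `U₀₀/50` plus `1/2000` of the toy
exponent `𝒜₁ U z = U₀₀z₀₀/10` (fluctuation-dependent). [folklore] -/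
def 𝒬w (U z : Fld 4 ℂ) : ℂ := ((1 / 50 : ℝ) : ℂ) * ev₀₀ U + ((1 / 2000 : ℝ) : ℂ) * 𝒜₁ U z

/-- The ACTION part: the rest, so that `𝒜w + 𝒬w = 𝒜₁` and the lineage's carried functionals `Fn` are unchanged. [folklore] -/
def 𝒜w (U z : Fld 4 ℂ) : ℂ := 𝒜₁ U z - 𝒬w U z

/-- The free fluctuation-constant part `q` of the observable-attached exponent (centred away by END-F). [folklore] -/
def qw (U : Fld 4 ℂ) : ℂ := ((1 / 50 : ℝ) : ℂ) * ev₀₀ U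

/-- The split recomposes the toy exponent. [folklore] -/
theorem 𝒜w_add_𝒬w : 𝒜w + 𝒬w = 𝒜₁ := by
  funext U z
  simp [𝒜w]

/-- The centred observable-attached exponent is `𝒜₁/2000`. [folklore] -/
theorem 𝒬w_sub_qw (U z : Fld 4 ℂ) : 𝒬w U z - qw U = ((1 / 2000 : ℝ) : ℂ) * 𝒜₁ U z := by
  simp [𝒬w, qw]

/-- The action part along a chart, measured against the reference: an explicit coefficient times the complex displacement
`U₀₀ + t·p₀₀ − Re U₀₀`. [arith] [folklore] -/
theorem 𝒜w_latMove_sub_ref (U₀ : Fld 4 ℂ) (p : NDir 4 ℂ) (t : ℂ) (z : Fld 4 ℂ) :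
    𝒜w (latMove U₀ p t) z - 𝒜w (ref₁ U₀) z =
      (((1999 / 2000 : ℝ) : ℂ) * (((1 / 10 : ℝ) : ℂ) * ev₀₀ z) - ((1 / 50 : ℝ) : ℂ)) *
        (ev₀₀ U₀ + t * ev₀₀ p.1.1 - (((ev₀₀ U₀).re : ℝ) : ℂ)) := by
  simp only [𝒜w, 𝒬w, 𝒜₁, ev₀₀_latMove, ev₀₀_ref₁]
  push_cast
  ring

/-- The coefficient is at most `1/25` in norm at both atoms of the fluctuation measure. [arith] [folklore] -/
theorem norm_coeff_le (z : Fld 4 ℂ) (hz : z = 0 ∨ z = atomH) :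
    ‖((1999 / 2000 : ℝ) : ℂ) * (((1 / 10 : ℝ) : ℂ) * ev₀₀ z) - ((1 / 50 : ℝ) : ℂ)‖ ≤ 1 / 25 := by
  rcases hz with rfl | rfl
  · rw [ev₀₀_zero, mul_zero, mul_zero, zero_sub, norm_neg, Complex.norm_real, Real.norm_eq_abs]
    norm_num
  · rw [ev₀₀_atomH]
    push_cast
    rw [show ((1999 / 2000 * (1 / 10 * (1 / 50)) - 1 / 50 : ℂ)) = (((1999 / 2000 * (1 / 10 * (1 / 50)) - 1 / 50 : ℝ)) : ℂ)
      by push_cast; ring, Complex.norm_real, Real.norm_eq_abs]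
    norm_num

/-! ## §2 END-F's weight binders on the split exponent: `hB`, `hE` for the action part, `hP` for the centred observable part -/

/-- `hB`: the real regular REFERENCE for the ACTION part — `base₁ ≡ 1 ≥ 0` with full support, and at `Re U₀` the action part
is real at both atoms; everything is integrable against the two-atom measure. [folklore] -/
theorem realBaseAt_w (S : Set (Fld 4 ℂ)) : RealBaseAt ref₁ base₁ 𝒜w flTwo S := by
  refine ⟨Eventually.of_forall fun _ => zero_le_one, ?_, fun U₀ _ => ⟨aesm_two _, ?_, integrable_two _⟩⟩
  · rw [show Function.support base₁ = univ from Function.support_const one_ne_zero]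
    simp [flTwo]
  · rw [ae_two]
    simp [𝒜w, 𝒬w, 𝒜₁, ev₀₀_ref₁, Complex.mul_im, Complex.mul_re]

/-- `hE`: the exponent slice of the ACTION part ABOUT THE REFERENCE on a window of radius `≤ 3`: `Ω = ball 0 (6/N)`,
holomorphy of a polynomial in `t`, oscillation `≤ (1/25)·(3 + 6 + 3) ≤ ½` at both atoms. [folklore] -/
theorem exponentSliceAt_w {ρ : ℝ} (hρ : ρ ≤ 3) :
    ExponentSliceAt ref₁ 𝒜w flTwo latMove latN (bondBall 4 ρ) 1 4 (1 / 2) := by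
  intro U₀ hU₀ p hp hp1
  have hu : ‖ev₀₀ U₀‖ ≤ 3 := (hU₀ 0 0).trans hρ
  refine ⟨ball 0 (6 / latN p), isOpen_ball, discs_subset_ball hp hp1 (by norm_num), fun t _ => aesm_two _,
    Eventually.of_forall fun z => ?_, ae_two.mpr ⟨fun t ht => ?_, fun t ht => ?_⟩⟩
  · show DifferentiableOn ℂ (fun t => 𝒜w (latMove U₀ p t) z) _
    simp only [𝒜w, 𝒬w, 𝒜₁, ev₀₀_latMove]
    fun_prop
  all_goals
    have h6 := norm_t_mul_le p hp ht
    have hre : ‖(((ev₀₀ U₀).re : ℝ) : ℂ)‖ ≤ 3 := by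
      rw [Complex.norm_real, Real.norm_eq_abs]; exact (Complex.abs_re_le_norm _).trans hu
    have hn : ‖ev₀₀ U₀ + t * ev₀₀ p.1.1 - (((ev₀₀ U₀).re : ℝ) : ℂ)‖ ≤ 12 :=
      calc _ ≤ ‖ev₀₀ U₀ + t * ev₀₀ p.1.1‖ + ‖(((ev₀₀ U₀).re : ℝ) : ℂ)‖ := norm_sub_le _ _
        _ ≤ (‖ev₀₀ U₀‖ + ‖t * ev₀₀ p.1.1‖) + ‖(((ev₀₀ U₀).re : ℝ) : ℂ)‖ := by gcongr; exact norm_add_le _ _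
        _ ≤ (3 + 6) + 3 := by gcongr
        _ = 12 := by norm_num
    rw [𝒜w_latMove_sub_ref, norm_mul]
  · calc _ ≤ (1 / 25 : ℝ) * 12 :=
          mul_le_mul (norm_coeff_le 0 (Or.inl rfl)) hn (norm_nonneg _) (by norm_num)
      _ ≤ 1 / 2 := by norm_num
  · calc _ ≤ (1 / 25 : ℝ) * 12 :=
          mul_le_mul (norm_coeff_le atomH (Or.inr rfl)) hn (norm_nonneg _) (by norm_num)
      _ ≤ 1 / 2 := by norm_num

/-- `hP` (raw size): the CENTRED observable-attached exponent `𝒬w − qw = 𝒜₁/2000` is a perturbation slice on a window of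
radius `≤ 3` with oscillation about `0` at most `(1/2000)·(9/500)` (`|U₀₀ + t·p₀₀| ≤ 9` on `Ω = ball 0 (6/N)`, `z₀₀ ∈ {0, 1/50}`).
[folklore] -/
theorem pertSlice_w {ρ : ℝ} (hρ : ρ ≤ 3) :
    PertSlice (fun U z => 𝒬w U z - qw U) flTwo latMove latN (bondBall 4 ρ) 1 4 (1 / 2000 * (9 / 500)) := by
  refine pertSlice_of_sup fun U₀ hU₀ p hp hp1 => ?_
  have hu : ‖ev₀₀ U₀‖ ≤ 3 := (hU₀ 0 0).trans hρ
  refine ⟨ball 0 (6 / latN p), isOpen_ball, discs_subset_ball hp hp1 (by norm_num), fun t _ => aesm_two _,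
    Eventually.of_forall fun z => ?_, ae_two.mpr ⟨fun t ht => ?_, fun t ht => ?_⟩⟩
  · show DifferentiableOn ℂ (fun t => 𝒬w (latMove U₀ p t) z - qw (latMove U₀ p t)) _
    simp only [𝒬w, qw, 𝒜₁, ev₀₀_latMove]
    fun_prop
  · simp only [𝒬w_sub_qw, 𝒜₁, ev₀₀_zero, mul_zero, norm_zero]
    norm_num
  · have h6 := norm_t_mul_le p hp ht
    have hn : ‖ev₀₀ U₀ + t * ev₀₀ p.1.1‖ ≤ 9 := (norm_add_le _ _).trans (by linarith)
    rw [𝒬w_sub_qw, 𝒜₁, ev₀₀_latMove, ev₀₀_atomH]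
    rw [show ((1 / 2000 : ℝ) : ℂ) * (((1 / 10 : ℝ) : ℂ) * (ev₀₀ U₀ + t * ev₀₀ p.1.1) * ((1 / 50 : ℝ) : ℂ)) =
      ((1 / 2000 * (1 / 10) * (1 / 50) : ℝ) : ℂ) * (ev₀₀ U₀ + t * ev₀₀ p.1.1) by push_cast; ring,
      norm_mul, Complex.norm_real, Real.norm_eq_abs, abs_of_pos (by norm_num)]
    calc (1 / 2000 * (1 / 10) * (1 / 50) : ℝ) * ‖ev₀₀ U₀ + t * ev₀₀ p.1.1‖
        ≤ (1 / 2000 * (1 / 10) * (1 / 50) : ℝ) * 9 := by gcongr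
      _ ≤ 1 / 2000 * (9 / 500) := by norm_num

/-! ## §3 The gate data: live families, action margins, source factor; the budget pays for `hP`; `e³ ≤ 32` -/

/-- Live families of the met component of `b` at step `k`: the family itself while the trajectory runs (`k ≤ 2`), none
beyond (so the positional count (w3-book) holds at every `k`). [folklore] -/
def SW (k : ℕ) (b : Bk.Birth) : Finset Bk.Birth := if k ≤ 2 then {b} else ∅

/-- Per-family, per-step action oscillation margins: `½` (= the `s` of `hE`). [folklore] -/
def sW : Bk.Birth → ℕ → ℝ := fun _ _ => 1 / 2

/-- The source-strength factor of the dressed budget: `2⁻²²` (it makes (w6) `hsmall` an equality, §4). [folklore] -/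
def mW : ℝ := 1 / 4194304

/-- The booked envelope of the toy family at every scale is at least its birth term `(4/5)·80 = 64` (nonnegative later terms,
step products of the rate `64` are `≥ 1`). [folklore] -/
theorem envVar_ge (b : Bk.Birth) (k : ℕ) : (64 : ℝ) ≤ Tr.envVar (4 * (1 / 5) / 1) (fun _ => (1 : ℝ) * 64) b k := by
  have h0 : (0 : ℕ) ∈ Finset.Icc (Bk.birthScale b) k := by
    show 0 ∈ Finset.Icc 0 k
    exact Finset.mem_Icc.mpr ⟨le_rfl, Nat.zero_le k⟩
  have hterm : (64 : ℝ) ≤ 4 * (1 / 5) / 1 * stepProd (fun _ => (1 : ℝ) * 64) 0 k * Tr.gen b 0 := by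
    rw [stepProd_const, Nat.sub_zero, one_mul, show Tr.gen b 0 = 80 from by simp [Tr, genT]]
    have h1 : (1 : ℝ) ≤ (64 : ℝ) ^ k := one_le_pow₀ (by norm_num)
    linarith
  refine hterm.trans ?_
  unfold Trajectory.envVar
  exact single_le_sum (f := fun k' => 4 * (1 / 5) / 1 * stepProd (fun _ => (1 : ℝ) * 64) k' k * Tr.gen b k')
    (fun k' _ => mul_nonneg (mul_nonneg (by norm_num) (stepProd_nonneg' k' k)) (Tr.gen_nonneg b k')) h0
  where
  /-- step products of the rate `64` are nonnegative. [folklore] -/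
  stepProd_nonneg' (k' k : ℕ) : (0 : ℝ) ≤ stepProd (fun _ => (1 : ℝ) * 64) k' k := by
    rw [stepProd_const]; positivity

/-- **THE BUDGET PAYS FOR `hP`**: while the trajectory runs, the dressed budget share `m·Σ_{f ∈ S k b} envVar f k = 2⁻²²·envVar b k`
is at least `2⁻¹⁶ ≥ (1/2000)·(9/500)`, the raw size of the centred observable slice. [arith] [folklore] -/
theorem budget_ge (b : Bk.Birth) {k : ℕ} (hk : k ≤ 2) :
    (1 / 2000 * (9 / 500) : ℝ) ≤ mW * ∑ f ∈ SW k b, Tr.envVar (4 * (1 / 5) / 1) (fun _ => (1 : ℝ) * 64) f k := by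
  rw [SW, if_pos hk, sum_singleton, mW]
  have h := envVar_ge b k
  nlinarith

/-- `e³ ≤ 32` (from Mathlib's nine-digit bound on `e`), so that `α ≡ 64` dominates the uniform step factor `e³·(1 + 4θ/ϱ) = 2e³`.
[arith] [folklore] -/
theorem exp_three_le : Real.exp 3 ≤ 32 := by
  have h1 : Real.exp 1 < 2.7182818286 := Real.exp_one_lt_d9
  have h0 : 0 < Real.exp 1 := Real.exp_pos 1
  have h3 : Real.exp 3 = Real.exp 1 ^ 3 := by rw [← Real.exp_nat_mul]; norm_num
  rw [h3]
  nlinarith [pow_le_pow_left₀ h0.le h1.le 3]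

/-! ## §4 END-F on the datum: the transport leaf `htr` BY NAME, gated by the dressed budget -/

/-- **THE JOINT WITNESS FOR END-F — its 21 hypothesis binders discharged at once on the datum, the gate being the dressed budget
`budgetGate Tr sW mW SW (4c_δ/r) (ψ·α)` itself** (not `True`): `hsl`/`hlin` the lineage's birth slices and trajectory currency,
`hFn` the literal `wOp` recursion read through the split `𝒜w + 𝒬w = 𝒜₁`, `hB`/`hE` §2 for the action part, `hP` §2 for the
centred observable part with its raw size dominated by the budget share (§3 `budget_ge`), window nesting by bond-ball arithmetic,
`hdom` by `e³ ≤ 32`.  Conclusion = END-F's, i.e. the field type of `BookingLeaves.htr` at `C = 4·(1/5)/1`, `ρ ≡ 1·64`. [folklore] -/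
theorem transportsFromVar_gated :
    Tr.TransportsFromVar (4 * (1 / 5) / 1) (fun _ => (1 : ℝ) * 64)
      (budgetGate Tr sW mW SW (4 * (1 / 5) / 1) (fun _ => (1 : ℝ) * 64)) :=
  transportLeaf_of_centredExponent (T := Tr) (F := ℂ) (Fn := fun _ k' k => Fn k' k)
    (rel := fun _ _ _ U U' => U = U') (𝒦 := fun _ _ k => Win k) (ref := fun _ _ => ref₁) (base := fun _ _ => base₁)
    (𝒜 := fun _ _ => 𝒜w) (𝒬 := fun _ _ => 𝒬w) (q := fun _ _ => qw) (μ := fun _ _ => flTwo) (z₀ := fun _ _ => 0)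
    (D := fun _ _ => Dfl) (defect := fun _ _ _ => 1 / 5) (cδ := 1 / 5) (ψ := 1) (w := 1) (r := 1) (m := mW)
    (s := sW) (θ := fun _ _ => 1) (α := fun _ => 64) (ϱ := fun _ _ _ => 4) (S := SW)
    (fun _ => by norm_num) one_pos one_pos
    (fun b k' hbk' hk' _ => hsl_toy b k' hbk' hk' fun _ _ => trivial)
    (fun _ k' k _ hk'k _ _ U => by rw [𝒜w_add_𝒬w]; exact Fn_succ hk'k U)
    (fun _ _ _ _ _ _ _ _ => mem_bddClass _) (fun _ _ => ⟨0, zero_mem_Dfl⟩) (fun _ _ _ => by norm_num)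
    (fun _ _ k _ _ _ _ => realBaseAt_w (Win (k + 1)))
    (fun _ _ k _ _ _ _ => exponentSliceAt_w (by simp only [rad]; push_cast; linarith))
    (fun b _ k _ _ hk _ => (pertSlice_w (ρ := rad (k + 1)) (by simp only [rad]; push_cast; linarith)).mono
      (budget_ge b (by change k + 1 ≤ 2 at hk; omega)) le_rfl Subset.rfl)
    (fun _ _ => ae_two.mpr ⟨zero_mem_Dfl, atomH_mem_Dfl⟩)
    (fun _ _ k _ _ _ => bondBall_add_mem (ρ' := rad (k + 1)) (s := 1 / 2) (ρ := rad k)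
      (by simp only [rad]; push_cast; linarith))
    (fun _ _ k _ _ _ => bondBall_latMove_add_mem (ρ' := rad (k + 1)) (w := 1) (s := 1 / 2) (ρ := rad k)
      (by simp only [rad]; push_cast; linarith))
    (fun _ _ z hz z' hz' x ν => by have h := bondBall_diam (s := 1 / 2) z hz z' hz' x ν; linarith)
    (fun _ _ => ⟨one_pos, le_rfl⟩)
    (fun _ _ _ _ _ _ => by nlinarith [exp_three_le, Real.exp_pos 3])
    (fun _ _ _ _ _ h => h ▸ rfl)
    (fun _ _ _ => by norm_num) (fun _ _ _ _ _ _ => by norm_num)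
    (fun b k' k hbk' hk'k hk _ => hlin_toy b k' k hbk' hk'k hk fun _ _ => trivial)

/-- Its reading at `(k′, k) = (0, 2)` under the dressed history: the unit booked size against the two-step transport of the
birth size `80` at rate `64`. [folklore] -/
example (hran : RanBelow (budgetGate Tr sW mW SW (4 * (1 / 5) / 1) (fun _ => (1 : ℝ) * 64)) 2) :
    (1 : ℝ) ≤ 4 * (1 / 5) / 1 * stepProd (fun _ => (1 : ℝ) * 64) 0 2 * 80 :=
  transportsFromVar_gated () 0 2 le_rfl (by norm_num) le_rfl hran

/-! ## §5 END-B's per-cutoff face behind END-F: one rational `UniformConstants`, the leaf binders, the class and the gates -/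

/-- THE CONSTANTS [decided toy]: `C = 4·(1/5)/1` (END-F's `4c_δ/r`), `A₀ = 64` (= `C·gen` at birth), `ρ₁ = 64` (= `ψ·α`, no
regeneration), `τ = 1`, `Λ = 1/128`, `N₀ = 16384 = 128²`, `ρ′ = 1/2` with (w7) `Λρ₁τ = ρ′` an equality, `s̄⁰ = 1/2`, `m = 2⁻²²`
with (w6) `m·N₀A₀(1−ρ′)⁻¹ = 1/2 = 1 − s̄⁰` an equality.  All rational, K- and μ-free (there is one cutoff and one run here).
[folklore] -/
def witnessConstants : UniformConstants where
  C := 4 * (1 / 5) / 1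
  A₀ := 64
  ρ₁ := 64
  τ := 1
  Λ := 1 / 128
  N₀ := 16384
  ρ' := 1 / 2
  sbar := 1 / 2
  m := mW
  hC := by norm_num
  hA₀ := by norm_num
  hρ₁ := by norm_num
  hτ0 := by norm_num
  hτ1 := le_rfl
  hΛ := by norm_num
  hN₀ := by norm_num
  hm := by norm_num [mW]
  hρ'1 := by norm_num
  hprod := by norm_num
  hsmall := by norm_num [mW]

/-- **THE LEAF BINDERS AT THE CUTOFF `K = 2`, WITH `htr` SUPPLIED BY END-F AT FUNCTION LEVEL** [decided toy]: rates `ψ·α ≡ 64`,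
no regeneration (`c ≡ 0`; the later generations are `0`), action margins `sW ≡ ½`, live families `SW`; (w7) `hrate` with
equality, (w3-book) `hS`/`hcount` (`1 ≤ 16384·128^{−(k−j)}` for `k − j ≤ 2`), (w2-act) `hs₀`, (w1) `hbirth` history-free through
`birthsFromOld_of_diag` (`C·80 = 64 = twoRate 64 64 1 2 0 0`), **T `htr := transportsFromVar_gated`** (§4, END-F by name),
(w5) `hreg` trivially. [folklore] -/
def witnessLeaves : BookingLeaves witnessConstants Bk Tr where
  ρ := fun _ => (1 : ℝ) * 64
  c := fun _ => 0
  s₀ := sW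
  S := SW
  hρ := fun _ => by norm_num
  hc := fun _ => le_rfl
  hrate := fun _ _ => by
    show (1 : ℝ) * 64 + 4 * (1 / 5) / 1 * 0 ≤ 64
    norm_num
  hS := fun k _ _ _ => Nat.zero_le k
  hcount := fun k b j hj => by
    show (((SW k b).filter fun _ => (0 : ℕ) = j).card : ℝ) ≤ 16384 * (1 / 128) ^ (k - j)
    unfold SW
    split_ifs with hk
    · have h1 : ((({b} : Finset Bk.Birth).filter fun _ => (0 : ℕ) = j).card : ℝ) ≤ 1 := by
        exact_mod_cast (Finset.card_filter_le _ _).trans (Finset.card_singleton b).le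
      have h2 : ((1 / 128 : ℝ)) ^ 2 ≤ (1 / 128 : ℝ) ^ (k - j) :=
        pow_le_pow_of_le_one (by norm_num) (by norm_num) (by omega)
      nlinarith
    · simp
  hs₀ := fun _ _ => by
    show (1 / 2 : ℝ) ≤ 1 / 2
    exact le_rfl
  hbirth := Trajectory.birthsFromOld_of_diag fun b => by
    show 4 * (1 / 5) / 1 * Tr.gen b (Bk.birthScale b) ≤ twoRate 64 64 1 Bk.K (Bk.birthScale b) (Bk.birthScale b)
    rw [show Bk.birthScale b = 0 from rfl, show Bk.K = 2 from rfl, show Tr.gen b 0 = 80 from by simp [Tr, genT]]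
    norm_num [twoRate]
  htr := transportsFromVar_gated
  hreg := fun b k _ _ _ => by
    show Tr.gen b (k + 1) ≤ 0 * Bk.size b k
    rw [show Tr.gen b (k + 1) = 0 from by simp [Tr, genT], zero_mul]

/-- **END-F THEN END-B's PER-CUTOFF FACE, AT FUNCTION LEVEL** [decided toy]: the booked observable-attached term of the datum
lies in the two-rate class `twoRate 64 64 1 2`, AND every dressed budget gate along the trajectory held — obtained from
`classAt_of_bookingLeaves` (i.e. `dressedBudget_closed` + `sizeBoundAt_of_envBoundAtVar`) on leaf binders whose transport leaf
came through END-F.  The joint binder family {END-F's 21} ∪ {END-B's per-cutoff leaves} is inhabited on one datum with a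
non-trivial gate. [folklore] -/
theorem classAt_through_ENDF :
    ClassAt Bk 64 64 1 ∧
      ∀ k, k ≤ Bk.K → RanBelow (budgetGate Tr sW mW SW (4 * (1 / 5) / 1) (fun _ => (1 : ℝ) * 64)) k :=
  classAt_of_bookingLeaves witnessLeaves

/-- In particular the dressed budget held at scales `0` and `1` (the two met steps). [folklore] -/
theorem budgetGate_holds {k : ℕ} (hk : k < 2) :
    budgetGate Tr sW mW SW (4 * (1 / 5) / 1) (fun _ => (1 : ℝ) * 64) k :=
  classAt_through_ENDF.2 2 le_rfl k hk

/-- **THE GATE IS A GENUINE CONSTRAINT ON THE DATUM**: with source factor `m = 1` instead of `2⁻²²` (all other data equal)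
the dressed budget FAILS at scale `0` (`½ + 1·64 > 1`) — so in the composition above (w6) `hsmall` is load-bearing and the
history premises of END-F's binders are not vacuous by fiat. [folklore] -/
theorem not_budgetGate_of_unit_source :
    ¬ budgetGate Tr sW 1 SW (4 * (1 / 5) / 1) (fun _ => (1 : ℝ) * 64) 0 := by
  intro h
  have h1 := h () le_rfl
  rw [sW, SW, if_pos (Nat.zero_le 2), sum_singleton, one_mul] at h1
  have h2 := envVar_ge () 0
  linarith

end Summit.QuantumFields.BalabanUV.T4Continuum.NE1p.DressedTransportWitness

end
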